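import Literature.MeasureTheory.Hausdorff.SphereCapAsymptotics
import HarnessLib

/-!
# Route `CylinderEntropy`, crux `CylinderRungTwo` (stmt-SmoothPoincare4-7631), line `killing-flux`:
# small caps of the unit `S⁴ ⊂ ℝ⁵` are asymptotically flat `4`-discs (registered helper
# `helper_smallCapAsymptotics`, step S6 of the area-quantization plan)

For `x ∈ S⁴ = {∑ i, x i ^ 2 = 1} ⊂ EuclideanSpace ℝ (Fin 5)` and Mathlib's un-normalised Hausdorff
measure `μH[4]`:

* `μH[4] (S⁴ ∩ B(x, ρ)) / μH[4] (B⁴(0, ρ)) → 1` as `ρ → 0⁺`, the disc `B⁴(0, ρ)` taken in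
  `EuclideanSpace ℝ (Fin 4)`;
* there is one `C < ∞` with `μH[4] (S⁴ ∩ B(x, ρ)) ≤ C · μH[4] (B⁴(0, ρ))` for EVERY `ρ > 0`.

In the area-quantization plan the weak limit of the area measures is a product
(uniform on `S⁴`) ⊗ σ, and its `4`-density at a point is computed from the first item by dominated
convergence over heights, the second item being the domination (consumer:
`helper_densityOfProductMeasure`).

Everything is PROVED, and the geometry lives in the tree:
`Literature/MeasureTheory/Hausdorff/SphereCapAsymptotics.lean` proves both items for the unit sphere
of every `(d+1)`-dimensional real inner product space — the cap `S^d ∩ B(x, r)` is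
`{⟪x, y⟫ > 1 - r²/2}`, it projects `1`-Lipschitz onto the disc of radius `r √(1 - r²/4)` of `xᗮ` and
is a `Λ(r)`-Lipschitz graph over it with `Λ(r) = 1 + √(r² - r⁴/4)/(1 - r²/2) → 1`, whence
`(1 - r²/4)^{d/2} ≤ μH[d] (cap) / μH[d] (B^d(0, r)) ≤ Λ(r)^d (1 - r²/4)^{d/2}` (the comparison is
done for Mathlib's normalised `μHE[d] = a_d • μH[d]`, where discs have measure `ω_d ρ^d`, and the
unknown constant `a_d` cancels) — and specialises them to `S⁴ ⊂ ℝ⁵` in the spelling of the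
registered signature (`tendsto_hausdorffMeasure_sphere_inter_ball_div_fin`,
`exists_hausdorffMeasure_sphere_inter_ball_le_fin`).  This file is the thin wrapper
`helper_smallCapAsymptotics` with the registered statement, verbatim.

References: H. Federer, *Geometric measure theory* (1969), 2.10.11, 3.2.19; P. Mattila, *Geometry
of sets and measures in Euclidean spaces* (1995), Chapters 4 and 7.
-/

-- the prescribed namespace `Summit.SmoothPoincare4.SmoothPoincare4.…` repeats `SmoothPoincare4`
set_option linter.dupNamespace false

noncomputable section

open MeasureTheory Set Filter
open scoped ENNReal NNReal Topology BigOperators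

namespace Summit.SmoothPoincare4.SmoothPoincare4.Cruxes.CylinderRungTwo.KillingFlux

open Literature.MeasureTheory.Hausdorff

/-- **Small caps of the unit `S⁴ ⊂ ℝ⁵` are asymptotically flat `4`-discs** (registered helper
`helper_smallCapAsymptotics`, step S6 of the area-quantization plan of line `killing-flux`): for
`∑ i, x i ^ 2 = 1`, `μH[4] (S⁴ ∩ B(x, ρ)) / μH[4] (B⁴(0, ρ)) → 1` as `ρ → 0⁺`, and
`μH[4] (S⁴ ∩ B(x, ρ)) ≤ C · μH[4] (B⁴(0, ρ))` for all `ρ > 0` with one `C < ∞`, the disc `B⁴(0, ρ)`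
taken in `EuclideanSpace ℝ (Fin 4)` (tree:
`Literature.MeasureTheory.Hausdorff.tendsto_hausdorffMeasure_sphere_inter_ball_div_fin`,
`Literature.MeasureTheory.Hausdorff.exists_hausdorffMeasure_sphere_inter_ball_le_fin`).
Cf. Federer 1969, 3.2.19. [folklore] -/
theorem helper_smallCapAsymptotics : ∀ x : EuclideanSpace ℝ (Fin 5), ∑ i : Fin 5, x i ^ 2 = 1 → Filter.Tendsto (fun ρ : ℝ => μH[4] (Metric.sphere (0 : EuclideanSpace ℝ (Fin 5)) 1 ∩ Metric.ball x ρ) / μH[4] (Metric.ball (0 : EuclideanSpace ℝ (Fin 4)) ρ)) (𝓝[>] 0) (𝓝 1) ∧ ∃ C : ℝ≥0∞, C < ⊤ ∧ ∀ ρ : ℝ, 0 < ρ → μH[4] (Metric.sphere (0 : EuclideanSpace ℝ (Fin 5)) 1 ∩ Metric.ball x ρ) ≤ C * μH[4] (Metric.ball (0 : EuclideanSpace ℝ (Fin 4)) ρ) :=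
  fun _ hx => ⟨tendsto_hausdorffMeasure_sphere_inter_ball_div_fin hx,
    exists_hausdorffMeasure_sphere_inter_ball_le_fin hx⟩

end Summit.SmoothPoincare4.SmoothPoincare4.Cruxes.CylinderRungTwo.KillingFlux

end
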